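import Summits.ResolutionOfSingularities.ResolutionOfSingularities.Theorems.PinchTowerTau

/-!
# NearExit (K1) — the generic `τ`-kernel of a near point of a point blow-up

Node «NearExit» of `decomp-res-lens-2` (g33): ring-level kernels towards the engine letter
`VeryNearCutClasses.VeryNearExit` (one point blow-up; [CossartPiltant2008] proof of Prop. 4.2 (a)(b)).

* `face_mem_of_tau_le_one` [KERNEL K1]: in a regular local ring `A` with `(x₀, t)` part of a regular system of
  parameters, if `J ⊆ 𝔪ⁿ` (`n ≥ 2`) contains `x₀ⁿ + t·(Φ + x₀·H)` and `τ(J, n) ≤ 1` (in any minimal basis), then the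
  «face coefficient» `Φ` lies in `(x₀, t) + 𝔪ⁿ`.  At a near point `x'` of the blow-up of a closed point this is the
  chart element `f' = x₀ⁿ + t·G(x)` (`t` the exceptional parameter, `Φ = G(0, x')` the face form): `τ(x') ≤ 1` forces
  the face form to vanish to order `≥ n` along the fibre — the generic exit of [CossartPiltant2008] Prop. 4.2.
  Proof (PinchTowerTau template): `f' ≡ c·ℓⁿ (mod 𝔪ⁿ⁺¹)` (`exists_sub_mem_pow_succ_of_tau_le_one`); `c ∈ 𝔪` gives
  `t·Φ ∈ (x₀) + 𝔪ⁿ⁺¹`; `c` a unit gives, modulo `(x₀, t)`, `ℓ ∈ (x₀, t) + 𝔪²`, `ℓ = x₀b₀ + tb₁ + μ`, and then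
  `t·(Φ − c tⁿ⁻¹ b₁ⁿ) ∈ (x₀) + 𝔪ⁿ⁺¹` (`add_pow_sub_pow_mem`); cancelling `t` in the regular local ring `A/(x₀)`
  (`mul_not_mem_pow_of_not_mem_pow`) yields the claim.  (Used contrapositively in `NearExitChart.two_le_tau_chart`:
  a face coefficient outside `(x₀, t) + 𝔪ⁿ` forces `τ ≥ 2`.)

Sources: [CossartPiltant2008] Prop. 4.2; [Hironaka1964] Ch. III §3; [CossartJannsenSaito2020] Ch. 2.
-/

open IsLocalRing
open Literature.AlgebraicGeometry.Resolution
open Summit.ResolutionOfSingularities.ResolutionOfSingularities.Theorems.PinchTower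

namespace Summit.ResolutionOfSingularities.ResolutionOfSingularities.Theorems.NearExit

section Tau

variable {A : Type} [CommRing A] [IsLocalRing A] [IsNoetherianRing A]

/-- **Cancelling a regular parameter**: `(x₀, t)` an r.s.o.p.-part, `t·a ∈ (x₀) + 𝔪ᵏ⁺¹ ⇒ a ∈ (x₀) + 𝔪ᵏ`
(in the regular local ring `A/(x₀)` the class `t̄ ∉ 𝔪̄²` has order one and orders add).
[cite: ZariskiSamuel1960, Ch. VIII §1 Thm. 1] -/
theorem mem_sup_pow_of_mul_mem {x₀ t a : A} (hxt : IsRsopPart ![x₀, t]) (k : ℕ)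
    (h : t * a ∈ Ideal.span (Set.range ![x₀]) ⊔ maximalIdeal A ^ (k + 1)) :
    a ∈ Ideal.span (Set.range ![x₀]) ⊔ maximalIdeal A ^ k := by
  classical
  have hx1 : IsRsopPart ![x₀] := by
    have := hxt.comp (fun _ : Fin 1 => (0 : Fin 2)) (fun a b _ => Subsingleton.elim a b)
    convert this using 1
    funext i; fin_cases i; rfl
  haveI hreg1 : IsRegularLocalRing (A ⧸ Ideal.span (Set.range ![x₀])) := hx1.isRegularLocalRing_quotient
  have htbar := mk_u_not_mem_sq hxt
  set K₁ : Ideal A := Ideal.span (Set.range ![x₀]) with hK₁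
  have h1 : Ideal.Quotient.mk K₁ t * Ideal.Quotient.mk K₁ a ∈ maximalIdeal (A ⧸ K₁) ^ (k + 1) := by
    rw [← map_mul]
    exact (mk_mem_pow_maximalIdeal_iff K₁ _ _).mpr h
  rw [← mk_mem_pow_maximalIdeal_iff K₁]
  rcases k with _ | k
  · rw [pow_zero, Ideal.one_eq_top]; exact Submodule.mem_top
  · by_contra ha
    have h2 := mul_not_mem_pow_of_not_mem_pow htbar ha
    rw [show 1 + k + 1 = k + 1 + 1 by ring] at h2
    exact h2 h1

/-- **THE GENERIC `τ`-KERNEL** [KERNEL K1]: `(x₀, t)` an r.s.o.p.-part, `n ≥ 2`, `J ⊆ 𝔪ⁿ`,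
`x₀ⁿ + t·(Φ + x₀·H) ∈ J`, `τ(J, n) ≤ 1` in a minimal basis `x` of `𝔪` ⇒ `Φ ∈ (x₀, t) + 𝔪ⁿ`.
[cite: CossartPiltant2008, Prop. 4.2] -/
theorem face_mem_of_tau_le_one {x₀ t Φ H : A} {J : Ideal A} {n : ℕ} (hxt : IsRsopPart ![x₀, t])
    (hn : 2 ≤ n) (hmem : x₀ ^ n + t * (Φ + x₀ * H) ∈ J) (hJ : J ≤ maximalIdeal A ^ n) {d : ℕ}
    (x : Fin d → A) (hx : Ideal.span (Set.range x) = maximalIdeal A) (hτ : hironakaTauAt x J n ≤ 1) :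
    Φ ∈ Ideal.span (Set.range ![x₀, t]) ⊔ maximalIdeal A ^ n := by
  classical
  obtain ⟨c, a, hca⟩ := exists_sub_mem_pow_succ_of_tau_le_one x hx (by omega) hτ hmem (hJ hmem)
  set ℓ := ∑ i, a i * x i with hℓ
  have hℓm : ℓ ∈ maximalIdeal A := by
    refine Ideal.sum_mem _ fun i _ => Ideal.mul_mem_left _ _ ?_
    rw [← hx]; exact Ideal.subset_span ⟨i, rfl⟩
  obtain ⟨n', hn'⟩ : ∃ n', n = n' + 1 := ⟨n - 1, by omega⟩
  have hx₀m : x₀ ∈ maximalIdeal A := hxt.mem_maximalIdeal 0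
  have htm : t ∈ maximalIdeal A := hxt.mem_maximalIdeal 1
  set K₁ : Ideal A := Ideal.span (Set.range ![x₀]) with hK₁
  set K₂ : Ideal A := Ideal.span (Set.range ![x₀, t]) with hK₂
  have hx₀K₁ : x₀ ∈ K₁ := Ideal.subset_span ⟨0, rfl⟩
  have hx₀K₂ : x₀ ∈ K₂ := Ideal.subset_span ⟨0, rfl⟩
  have htK₂ : t ∈ K₂ := Ideal.subset_span ⟨1, rfl⟩
  have hK12 : K₁ ≤ K₂ := by
    rw [hK₁, Ideal.span_le]
    rintro _ ⟨i, rfl⟩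
    fin_cases i
    exact hx₀K₂
  -- MAIN CLAIM: `t·(Φ − s) ∈ (x₀) + 𝔪ⁿ⁺¹` for some `s ∈ (x₀, t)`
  have main : ∃ s ∈ K₂, t * (Φ - s) ∈ K₁ ⊔ maximalIdeal A ^ (n + 1) := by
    -- the shape `h − c (t b₁)ⁿ = x₀·(x₀ⁿ' + t H) + t·(Φ − c tⁿ' b₁ⁿ)`
    have shape : ∀ b₁ : A, x₀ ^ n + t * (Φ + x₀ * H) - c * (t * b₁) ^ n =
        x₀ * (x₀ ^ n' + t * H) + t * (Φ - c * t ^ n' * b₁ ^ n) := by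
      intro b₁
      rw [hn', mul_pow, pow_succ, pow_succ]
      ring
    by_cases hc : c ∈ maximalIdeal A
    · -- `c ∈ 𝔪`: `h ∈ 𝔪ⁿ⁺¹`
      refine ⟨c * t ^ n' * 0 ^ n, Ideal.mul_mem_right _ _ (Ideal.mul_mem_left _ _ ?_), ?_⟩
      · obtain ⟨n'', hn''⟩ : ∃ n'', n' = n'' + 1 := ⟨n' - 1, by omega⟩
        rw [hn'', pow_succ]
        exact Ideal.mul_mem_left _ _ htK₂
      have hcl : c * ℓ ^ n ∈ maximalIdeal A ^ (n + 1) := by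
        rw [pow_succ']; exact Ideal.mul_mem_mul hc (Ideal.pow_mem_pow hℓm n)
      have hh : x₀ ^ n + t * (Φ + x₀ * H) - c * (t * 0) ^ n ∈ maximalIdeal A ^ (n + 1) := by
        rw [mul_zero, zero_pow (by omega), mul_zero, sub_zero]
        have := Ideal.add_mem _ hca hcl
        rwa [sub_add_cancel] at this
      rw [shape 0] at hh
      have heq : t * (Φ - c * t ^ n' * 0 ^ n) =
          x₀ * (x₀ ^ n' + t * H) + t * (Φ - c * t ^ n' * 0 ^ n) - x₀ * (x₀ ^ n' + t * H) := by ring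
      rw [heq]
      exact Ideal.sub_mem _ (Ideal.mem_sup_right hh) (Ideal.mem_sup_left (Ideal.mul_mem_right _ _ hx₀K₁))
    · -- `c` a unit: modulo `(x₀, t)` the class of `ℓⁿ` lies in `𝔪̿ⁿ⁺¹`, so `ℓ ∈ (x₀, t) + 𝔪²`
      have hcu : IsUnit c := IsLocalRing.notMem_maximalIdeal.mp hc
      haveI hreg2 : IsRegularLocalRing (A ⧸ K₂) := hxt.isRegularLocalRing_quotient
      have hhK : x₀ ^ n + t * (Φ + x₀ * H) ∈ K₂ := by
        refine Ideal.add_mem _ ?_ (Ideal.mul_mem_right _ _ htK₂)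
        rw [hn', pow_succ']; exact Ideal.mul_mem_right _ _ hx₀K₂
      have h1 : Ideal.Quotient.mk K₂ (c * ℓ ^ n) ∈ maximalIdeal (A ⧸ K₂) ^ (n + 1) := by
        have h' : c * ℓ ^ n = (x₀ ^ n + t * (Φ + x₀ * H)) - (x₀ ^ n + t * (Φ + x₀ * H) - c * ℓ ^ n) := by
          ring
        rw [h', map_sub, Ideal.Quotient.eq_zero_iff_mem.mpr hhK, zero_sub, neg_mem_iff,
          ← map_mk_maximalIdeal_eq K₂, ← Ideal.map_pow]
        exact Ideal.mem_map_of_mem _ hca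
      have h2 : Ideal.Quotient.mk K₂ ℓ ^ n ∈ maximalIdeal (A ⧸ K₂) ^ (n + 1) := by
        rw [map_mul, map_pow] at h1
        obtain ⟨w, hw⟩ := hcu.map (Ideal.Quotient.mk K₂)
        have heq : Ideal.Quotient.mk K₂ ℓ ^ n = ↑w⁻¹ * (Ideal.Quotient.mk K₂ c * Ideal.Quotient.mk K₂ ℓ ^ n) := by
          rw [← hw, ← mul_assoc, Units.inv_mul, one_mul]
        rw [heq]
        exact Ideal.mul_mem_left _ _ h1
      have h3 : Ideal.Quotient.mk K₂ ℓ ∈ maximalIdeal (A ⧸ K₂) ^ 2 := by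
        by_contra hℓ2
        have := pow_not_mem_pow_of_not_mem_pow hℓ2 n
        rw [mul_one] at this
        exact this h2
      have h4 : ℓ ∈ K₂ ⊔ maximalIdeal A ^ 2 := (mk_mem_pow_maximalIdeal_iff K₂ ℓ 2).mp h3
      obtain ⟨p, hp, μ, hμ, hpμ⟩ := Submodule.mem_sup.mp h4
      obtain ⟨b, hb⟩ := Ideal.mem_span_range_iff_exists_fun.mp hp
      -- `ℓ = x₀ b₀ + t b₁ + μ`
      have hℓeq : ℓ = x₀ * b 0 + (t * b 1 + μ) := by
        rw [← hpμ, ← hb, Fin.sum_univ_two]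
        simp only [Matrix.cons_val_zero, Matrix.cons_val_one]
        ring
      obtain ⟨q, hq⟩ : ∃ q, ℓ ^ n - (t * b 1 + μ) ^ n = x₀ * b 0 * q := by
        have hd := sub_dvd_pow_sub_pow ℓ (t * b 1 + μ) n
        rw [hℓeq, add_sub_cancel_right] at hd
        rw [hℓeq]
        exact hd
      have hstep : (t * b 1 + μ) ^ n - (t * b 1) ^ n ∈ maximalIdeal A ^ (n + 1) :=
        add_pow_sub_pow_mem (Ideal.mul_mem_right _ _ htm) hμ n
      refine ⟨c * t ^ n' * b 1 ^ n, Ideal.mul_mem_right _ _ (Ideal.mul_mem_left _ _ ?_), ?_⟩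
      · obtain ⟨n'', hn''⟩ : ∃ n'', n' = n'' + 1 := ⟨n' - 1, by omega⟩
        rw [hn'', pow_succ]
        exact Ideal.mul_mem_left _ _ htK₂
      have hfinal : x₀ ^ n + t * (Φ + x₀ * H) - c * (t * b 1) ^ n ∈ K₁ ⊔ maximalIdeal A ^ (n + 1) := by
        have heq : x₀ ^ n + t * (Φ + x₀ * H) - c * (t * b 1) ^ n =
            (x₀ ^ n + t * (Φ + x₀ * H) - c * ℓ ^ n) + c * ((t * b 1 + μ) ^ n - (t * b 1) ^ n) +
              c * (ℓ ^ n - (t * b 1 + μ) ^ n) := by ring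
        rw [heq, hq]
        refine Ideal.add_mem _ (Ideal.mem_sup_right (Ideal.add_mem _ hca (Ideal.mul_mem_left _ _ hstep)))
          (Ideal.mem_sup_left ?_)
        exact Ideal.mul_mem_left _ _ (Ideal.mul_mem_right _ _ (Ideal.mul_mem_right _ _ hx₀K₁))
      rw [shape (b 1)] at hfinal
      have heq : t * (Φ - c * t ^ n' * b 1 ^ n) =
          x₀ * (x₀ ^ n' + t * H) + t * (Φ - c * t ^ n' * b 1 ^ n) - x₀ * (x₀ ^ n' + t * H) := by ring
      rw [heq]
      exact Ideal.sub_mem _ hfinal (Ideal.mem_sup_left (Ideal.mul_mem_right _ _ hx₀K₁))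
  obtain ⟨s, hs, hts⟩ := main
  have h5 : Φ - s ∈ K₁ ⊔ maximalIdeal A ^ n := mem_sup_pow_of_mul_mem hxt n hts
  have heq : Φ = (Φ - s) + s := by ring
  rw [heq]
  exact Ideal.add_mem _ (sup_le_sup_right hK12 _ h5) (Ideal.mem_sup_left hs)

end Tau

end Summit.ResolutionOfSingularities.ResolutionOfSingularities.Theorems.NearExit
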